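import Mathlib.RingTheory.Ideal.Operations
import Mathlib.Tactic.Ring
import Mathlib.Tactic.NormNum
import HarnessLib

/-!
# [OURS · L1 W4.5(b) · EL♮(3)] Specimen «customer #4» — the RATIONAL (6,10,15)-NOSE, local model at q: chart identities of ORDER A, levels 0–3
# (customer side, res-L1-w45b-lead-1 g22; memos `L/res-L1-w45b-lead-1/EQUISINGULAR-NOSES.md` (4.3′)/(6.6), `C4-ORDER-A-LEVELS.md`; idea-3 `DEEPPT-LEMMAS-idea3.md` §9–§10;
# crux `EquisingularLiftNatThree`, stmt-ResolutionOfSingularities-20148; desk R79: customer #4 BOOKED, D17 booked-not-dealt)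

NOT a statement of any manuscript; OURS kernel specimen.  AI-written, weaker than expert review.  Nothing of [Hironaka2017] is asserted; EL♮(3) is NOT proved here;
this file does NOT prove any door membership or non-membership (those are the memos' by-letters certificates).  It certifies the ring identities the level list of
record rests on (kit j331225 walks the same model chart by chart).
THE OBJECT: `F = a·f₁² + b·f₁f₂ + c·f₂²`, `f₁ = x⁵ − y³`, `f₂ = z² − y³` (`Z = V(f₁,f₂)` = the monomial curve `(t⁶,t¹⁰,t¹⁵)`, `q` = origin; `a b c` units with
`b² − 4ac` a unit — here arbitrary ring elements: every identity below is polynomial in them).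
* `F_mem_sq`            : `F ∈ (f₁, f₂)²` (H singular along Z);
* `qstep_chart_x/y/z`   : the point step at `q`, three charts; chart x: `F(x, xy, xz) = x⁴·F₁`, `F₁ = c·f₂′² + b·x·f₁′f₂′ + a·x²·f₁′²` with `(f₁′, f₂′) = (x² − y³, z² − xy³)`
                          (the ⟨4,6,9⟩ CI at `p₁`); `F₁_cone`: `F₁ = c·z⁴ + (order ≥ 5)` — the QUADRUPLE PLANE `4·T Π_q` (idea-3 (9.2)); chart z carries no point of `T̃₁` at its origin;
* `lamround_chart_A/B`  : ORDER A's round along `λ_q = V(x, z) ⊂ Π_q`: chart A (`z = x·z′`): `F₁ = x²·G`, `G = c·(xz² − y³)² + b·(x² − y³)(xz² − y³) + a·(x² − y³)²` — ALL THREE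
                          coefficients units again at `P_A` (idea-3 (10.2)); `G_cone`: `G = a·x⁴ + (order ≥ 5)` = the quadruple plane `4·T R_λ`; chart B (`x = x′·z`): `F₁ = z²·G'`,
                          `G'_order_two`: `G' = c·z² + (order ≥ 3)` at `P_B = σ ∩ μ`;
* `PAstep_chart_z`      : the point step at `P_A`, chart z (`x = x″z, y = y″z`): `G = z⁴·G₃`, `G₃ = c·z²(x − y³)² + b·z(x² − y³z)(x − y³) + a·(x² − y³z)²`;
                          `G₃_cone`: `G₃ = x²(a·x² + b·xz + c·z²) + (order ≥ 5)` at `P_A′` (idea-3 (10.2): mult 4, cone `x²·Q`); `G₃_vanishes_on_Zst`: `G₃(t³, t, t³) = 0`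
                          (`Z^st₃ = (t³, t, t³)`, a smooth graph over `y` — Z is resolved over q after TWO point steps in ORDER A).
* (appended) `muround_chart_y`, `G₃L_cone`, `G₃L_vanishes_on_Zst`, `nuround_chart_z`, `G₄L_cone`, `G₄L_vanishes_on_Zst`: ORDER L's levels 3–4 (rounds along the fibres
                          `μ`, `ν` instead of the point step at `P_A`; cones `(a+b+c)·y⁴ = 4·T R_μ` and `c·x²z²`; `Z^st₄ = (t², t, t³)` smooth) — kit j331424, memo `C4-LEVELS.md`.
* (appended) `infstep_chart_z`, `F₁inf_A7_form`, `pprime_step_chart_y`, `g₂_vanishes_on_Zst`, `g₂_on_StS`: the ∞-end (planar point of Z₁₅): ∞-step, the A₇ line `λ_∞`,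
                          the p′-step, `Z^st₂ = (0, s⁴, s)` regular, `g₂|_{St²S} = y³z²(y − z⁴)` (A₁₃ along `λ_{p′}`, contact 4) — kits j331484/j331485, idea-3 l.38509.
`--supports stmt-ResolutionOfSingularities-20148 --as helper`; def-free; standard axioms.
-/

set_option linter.dupNamespace false -- mandated namespace `Summit.<Summit>.<Problem>` of this single-conjunct summit

namespace Summit.ResolutionOfSingularities.ResolutionOfSingularities.Cruxes.EquisingularLiftNat.Sections

namespace SpecimenRationalNose615

variable {R : Type} [CommRing R]

/-- [OURS · L1 W4.5b] `a f₁² + b f₁f₂ + c f₂² ∈ (f₁, f₂)²` — the nose surface is singular along `Z = V(f₁, f₂)`. [folklore] -/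
theorem F_mem_sq (a b c f₁ f₂ : R) :
    a * f₁ ^ 2 + b * f₁ * f₂ + c * f₂ ^ 2 ∈ (Ideal.span {f₁, f₂}) ^ 2 := by
  have h1 : f₁ ∈ Ideal.span ({f₁, f₂} : Set R) := Ideal.subset_span (Set.mem_insert _ _)
  have h2 : f₂ ∈ Ideal.span ({f₁, f₂} : Set R) := Ideal.subset_span (Set.mem_insert_of_mem _ (Set.mem_singleton _))
  refine Ideal.add_mem _ (Ideal.add_mem _ ?_ ?_) ?_
  · exact Ideal.mul_mem_left _ _ (Ideal.pow_mem_pow h1 2)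
  · have : f₁ * f₂ ∈ (Ideal.span ({f₁, f₂} : Set R)) ^ 2 := by
      rw [pow_two]; exact Ideal.mul_mem_mul h1 h2
    simpa [mul_assoc] using Ideal.mul_mem_left _ b this
  · exact Ideal.mul_mem_left _ _ (Ideal.pow_mem_pow h2 2)

/-- [OURS · L1 W4.5b] Level 1, chart x of the point step at q (`y ↦ xy, z ↦ xz`): `F = x⁴·F₁`, `F₁ = c f₂′² + b x f₁′f₂′ + a x² f₁′²`, `(f₁′, f₂′) = (x² − y³, z² − xy³)`. [folklore] -/
theorem qstep_chart_x (a b c x y z : R) :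
    a * (x ^ 5 - (x * y) ^ 3) ^ 2 + b * (x ^ 5 - (x * y) ^ 3) * ((x * z) ^ 2 - (x * y) ^ 3) + c * ((x * z) ^ 2 - (x * y) ^ 3) ^ 2 =
      x ^ 4 * (c * (z ^ 2 - x * y ^ 3) ^ 2 + b * x * (x ^ 2 - y ^ 3) * (z ^ 2 - x * y ^ 3) + a * x ^ 2 * (x ^ 2 - y ^ 3) ^ 2) := by
  ring

/-- [OURS · L1 W4.5b] `F₁ = c·z⁴ + (terms of order ≥ 5 at p₁ = origin)`: the tangent cone of `T̃₁` at `p₁` is the quadruple plane `z⁴ = 4·T Π_q` (`Π_q = {x = 0}`). [folklore] -/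
theorem F₁_cone (a b c x y z : R) :
    c * (z ^ 2 - x * y ^ 3) ^ 2 + b * x * (x ^ 2 - y ^ 3) * (z ^ 2 - x * y ^ 3) + a * x ^ 2 * (x ^ 2 - y ^ 3) ^ 2 =
      c * z ^ 4 + (b * x ^ 3 * z ^ 2 - 2 * c * x * y ^ 3 * z ^ 2 - b * x * y ^ 3 * z ^ 2 + a * x ^ 6 - b * x ^ 4 * y ^ 3
        - 2 * a * x ^ 4 * y ^ 3 + c * x ^ 2 * y ^ 6 + b * x ^ 2 * y ^ 6 + a * x ^ 2 * y ^ 6) := by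
  ring

/-- [OURS · L1 W4.5b] Level 1, chart y of the point step at q (`x ↦ xy, z ↦ yz`): `F = y⁴·(a y²(x⁵y² − 1)² + b y (x⁵y² − 1)(z² − y) + c (z² − y)²)` (`Π_q = {y = 0}`;
this chart carries the rest of the line `λ_q = V(y, z)`, along which `T̃₁` has order 2). [folklore] -/
theorem qstep_chart_y (a b c x y z : R) :
    a * ((x * y) ^ 5 - y ^ 3) ^ 2 + b * ((x * y) ^ 5 - y ^ 3) * ((y * z) ^ 2 - y ^ 3) + c * ((y * z) ^ 2 - y ^ 3) ^ 2 =
      y ^ 4 * (a * y ^ 2 * (x ^ 5 * y ^ 2 - 1) ^ 2 + b * y * (x ^ 5 * y ^ 2 - 1) * (z ^ 2 - y) + c * (z ^ 2 - y) ^ 2) := by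
  ring

/-- [OURS · L1 W4.5b] Level 1, chart z of the point step at q (`x ↦ xz, y ↦ yz`): `F = z⁴·(a z²(x⁵z² − y³)² + b z (x⁵z² − y³)(1 − y³z) + c (1 − y³z)²)`; at the chart origin the
strict transform takes the value `c` (a unit): no point of `T̃₁` there. [folklore] -/
theorem qstep_chart_z (a b c x y z : R) :
    a * ((x * z) ^ 5 - (y * z) ^ 3) ^ 2 + b * ((x * z) ^ 5 - (y * z) ^ 3) * (z ^ 2 - (y * z) ^ 3) + c * (z ^ 2 - (y * z) ^ 3) ^ 2 =
      z ^ 4 * (a * z ^ 2 * (x ^ 5 * z ^ 2 - y ^ 3) ^ 2 + b * z * (x ^ 5 * z ^ 2 - y ^ 3) * (1 - y ^ 3 * z) + c * (1 - y ^ 3 * z) ^ 2) := by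
  ring

/-- [OURS · L1 W4.5b] Level 2 (ORDER A), chart A of the round along `λ_q = V(x, z)` (`z ↦ xz`): `F₁ = x²·G` with the ALL-UNIT form
`G = c (xz² − y³)² + b (x² − y³)(xz² − y³) + a (x² − y³)²` at `P_A` = origin (`R_λ = {x = 0}`; `Z^st₂ = (t⁶, t⁴, t³)`). [folklore] -/
theorem lamround_chart_A (a b c x y z : R) :
    c * ((x * z) ^ 2 - x * y ^ 3) ^ 2 + b * x * (x ^ 2 - y ^ 3) * ((x * z) ^ 2 - x * y ^ 3) + a * x ^ 2 * (x ^ 2 - y ^ 3) ^ 2 =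
      x ^ 2 * (c * (x * z ^ 2 - y ^ 3) ^ 2 + b * (x ^ 2 - y ^ 3) * (x * z ^ 2 - y ^ 3) + a * (x ^ 2 - y ^ 3) ^ 2) := by
  ring

/-- [OURS · L1 W4.5b] `G = a·x⁴ + (order ≥ 5)`: the tangent cone of `T̃₂` at `P_A` is the quadruple plane `x⁴ = 4·T R_λ` (idea-3 (10.2)). [folklore] -/
theorem G_cone (a b c x y z : R) :
    c * (x * z ^ 2 - y ^ 3) ^ 2 + b * (x ^ 2 - y ^ 3) * (x * z ^ 2 - y ^ 3) + a * (x ^ 2 - y ^ 3) ^ 2 =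
      a * x ^ 4 + (b * x ^ 3 * z ^ 2 - 2 * a * x ^ 2 * y ^ 3 - b * x ^ 2 * y ^ 3 + c * x ^ 2 * z ^ 4 - b * x * y ^ 3 * z ^ 2
        - 2 * c * x * y ^ 3 * z ^ 2 + a * y ^ 6 + b * y ^ 6 + c * y ^ 6) := by
  ring

/-- [OURS · L1 W4.5b] Level 2 (ORDER A), chart B of the round along `λ_q` (`x ↦ xz`): `F₁ = z²·G'`, `G' = c (z − xy³)² + b x (x²z² − y³)(z − xy³) + a x² (x²z² − y³)²`
(`R_λ = {z = 0}`, `St Π_q = {x = 0}`, `σ = V(x, z)`, `μ = V(y, z)`, `P_B` = origin). [folklore] -/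
theorem lamround_chart_B (a b c x y z : R) :
    c * (z ^ 2 - (x * z) * y ^ 3) ^ 2 + b * (x * z) * ((x * z) ^ 2 - y ^ 3) * (z ^ 2 - (x * z) * y ^ 3) + a * (x * z) ^ 2 * ((x * z) ^ 2 - y ^ 3) ^ 2 =
      z ^ 2 * (c * (z - x * y ^ 3) ^ 2 + b * x * (x ^ 2 * z ^ 2 - y ^ 3) * (z - x * y ^ 3) + a * x ^ 2 * (x ^ 2 * z ^ 2 - y ^ 3) ^ 2) := by
  ring

/-- [OURS · L1 W4.5b] `G' = c·z² + (order ≥ 3)` at `P_B`: order 2, tangent cone the DOUBLE plane `z² = 2·T R_λ` (the crossing `σ ∩ μ` is not a deep point). [folklore] -/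
theorem G'_order_two (a b c x y z : R) :
    c * (z - x * y ^ 3) ^ 2 + b * x * (x ^ 2 * z ^ 2 - y ^ 3) * (z - x * y ^ 3) + a * x ^ 2 * (x ^ 2 * z ^ 2 - y ^ 3) ^ 2 =
      c * z ^ 2 + (-(2 * c * x * y ^ 3 * z) + c * x ^ 2 * y ^ 6 + b * x ^ 3 * z ^ 3 - b * x ^ 4 * y ^ 3 * z ^ 2 - b * x * y ^ 3 * z
        + b * x ^ 2 * y ^ 6 + a * x ^ 6 * z ^ 4 - 2 * a * x ^ 4 * y ^ 3 * z ^ 2 + a * x ^ 2 * y ^ 6) := by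
  ring

/-- [OURS · L1 W4.5b] Level 3 (ORDER A), chart z of the point step at `P_A` (`x ↦ xz, y ↦ yz`): `G = z⁴·G₃`,
`G₃ = c z²(x − y³)² + b z (x² − y³z)(x − y³) + a (x² − y³z)²` (`Π_{P_A} = {z = 0}`). [folklore] -/
theorem PAstep_chart_z (a b c x y z : R) :
    c * ((x * z) * z ^ 2 - (y * z) ^ 3) ^ 2 + b * ((x * z) ^ 2 - (y * z) ^ 3) * ((x * z) * z ^ 2 - (y * z) ^ 3) + a * ((x * z) ^ 2 - (y * z) ^ 3) ^ 2 =
      z ^ 4 * (c * z ^ 2 * (x - y ^ 3) ^ 2 + b * z * (x ^ 2 - y ^ 3 * z) * (x - y ^ 3) + a * (x ^ 2 - y ^ 3 * z) ^ 2) := by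
  ring

/-- [OURS · L1 W4.5b] `G₃ = x²·(a x² + b xz + c z²) + (order ≥ 5)` at `P_A′` = origin: multiplicity 4, tangent cone `x²·Q(x, z)` with `Q` the nose's quadratic form
(idea-3 (10.2)). [folklore] -/
theorem G₃_cone (a b c x y z : R) :
    c * z ^ 2 * (x - y ^ 3) ^ 2 + b * z * (x ^ 2 - y ^ 3 * z) * (x - y ^ 3) + a * (x ^ 2 - y ^ 3 * z) ^ 2 =
      x ^ 2 * (a * x ^ 2 + b * x * z + c * z ^ 2) + (-(2 * c * x * y ^ 3 * z ^ 2) + c * y ^ 6 * z ^ 2 - b * x ^ 2 * y ^ 3 * z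
        - b * x * y ^ 3 * z ^ 2 + b * y ^ 6 * z ^ 2 - 2 * a * x ^ 2 * y ^ 3 * z + a * y ^ 6 * z ^ 2) := by
  ring

/-- [OURS · L1 W4.5b] `Z^st₃ = (t³, t, t³)` lies on `T̃₃`: `G₃(t³, t, t³) = 0` — the strict transform of `Z` over `q` is a smooth graph over `y` after the TWO point steps
`q, P_A` of ORDER A (idea-3 (10.2); ORDER B needs four). [folklore] -/
theorem G₃_vanishes_on_Zst (a b c t : R) :
    c * (t ^ 3) ^ 2 * (t ^ 3 - t ^ 3) ^ 2 + b * t ^ 3 * ((t ^ 3) ^ 2 - t ^ 3 * t ^ 3) * (t ^ 3 - t ^ 3) + a * ((t ^ 3) ^ 2 - t ^ 3 * t ^ 3) ^ 2 = 0 := by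
  ring

/-! ### (appended, lead-1 g22 ≈13:30Z) ORDER L, levels 3–4: the rounds along `μ` and `ν` instead of the point step at `P_A`
Kit j331424 (`L/res-L1-w45b-lead-1/C4-LEVELS.md` §2): in the letter-greedy order the fibre `μ = V(x, y)` of `R_λ` over `p₁` (the tangent line of the ⟨3,4⟩-cusp
`Z^st₂ = (t⁶,t⁴,t³)` at `P_A`) is blown up at level 3 and the fibre `ν = V(y, z)` of `R_μ` over `P_A` at level 4; `Z^st` comes out SMOOTH with no point step at `P_A`. -/

/-- [OURS · L1 W4.5b] Level 3 (ORDER L), chart y of the round along `μ = V(x, y) ⊂ R_λ` (`x ↦ xy`): `G = y²·G₃`,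
`G₃ = c (xz² − y²)² + b y (x² − y)(xz² − y²) + a y² (x² − y)²` (`R_μ = {y = 0}`; `Z^st₃ = (t², t⁴, t³)`, the ⟨2,3,4⟩-cusp). [folklore] -/
theorem muround_chart_y (a b c x y z : R) :
    c * ((x * y) * z ^ 2 - y ^ 3) ^ 2 + b * ((x * y) ^ 2 - y ^ 3) * ((x * y) * z ^ 2 - y ^ 3) + a * ((x * y) ^ 2 - y ^ 3) ^ 2 =
      y ^ 2 * (c * (x * z ^ 2 - y ^ 2) ^ 2 + b * y * (x ^ 2 - y) * (x * z ^ 2 - y ^ 2) + a * y ^ 2 * (x ^ 2 - y) ^ 2) := by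
  ring

/-- [OURS · L1 W4.5b] `G₃ = (a + b + c)·y⁴ + (order ≥ 5)`: the tangent cone of `T̃₃` at the origin is the QUADRUPLE PLANE `4·T R_μ` (kit: cone `(a+b+c)·y⁴`; `a + b + c = Q(1,1) ≠ 0`
for the two sheets). [folklore] -/
theorem G₃L_cone (a b c x y z : R) :
    c * (x * z ^ 2 - y ^ 2) ^ 2 + b * y * (x ^ 2 - y) * (x * z ^ 2 - y ^ 2) + a * y ^ 2 * (x ^ 2 - y) ^ 2 =
      (a + b + c) * y ^ 4 + (c * x ^ 2 * z ^ 4 - 2 * c * x * y ^ 2 * z ^ 2 + b * x ^ 3 * y * z ^ 2 - b * x ^ 2 * y ^ 3 - b * x * y ^ 2 * z ^ 2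
        + a * x ^ 4 * y ^ 2 - 2 * a * x ^ 2 * y ^ 3) := by
  ring

/-- [OURS · L1 W4.5b] `Z^st₃ = (t², t⁴, t³)` lies on `T̃₃`: `G₃(t², t⁴, t³) = 0`. [folklore] -/
theorem G₃L_vanishes_on_Zst (a b c t : R) :
    c * (t ^ 2 * (t ^ 3) ^ 2 - (t ^ 4) ^ 2) ^ 2 + b * t ^ 4 * ((t ^ 2) ^ 2 - t ^ 4) * (t ^ 2 * (t ^ 3) ^ 2 - (t ^ 4) ^ 2) + a * (t ^ 4) ^ 2 * ((t ^ 2) ^ 2 - t ^ 4) ^ 2 = 0 := by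
  ring

/-- [OURS · L1 W4.5b] Level 4 (ORDER L), chart z of the round along `ν = V(y, z) ⊂ R_μ` (`y ↦ yz`): `G₃ = z²·G₄`,
`G₄ = c z² (x − y²)² + b y z (x² − yz)(x − y²) + a y² (x² − yz)²` (`R_ν = {z = 0}`). [folklore] -/
theorem nuround_chart_z (a b c x y z : R) :
    c * (x * z ^ 2 - (y * z) ^ 2) ^ 2 + b * (y * z) * (x ^ 2 - y * z) * (x * z ^ 2 - (y * z) ^ 2) + a * (y * z) ^ 2 * (x ^ 2 - y * z) ^ 2 =
      z ^ 2 * (c * z ^ 2 * (x - y ^ 2) ^ 2 + b * y * z * (x ^ 2 - y * z) * (x - y ^ 2) + a * y ^ 2 * (x ^ 2 - y * z) ^ 2) := by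
  ring

/-- [OURS · L1 W4.5b] `G₄ = c·x²z² + (order ≥ 5)`: at the triple point `R_λ ∩ R_μ ∩ R_ν` (origin of this chart) `T̃₄` has multiplicity 4 with tangent cone `c·x²z²`
(kit: cone `c·z²·x²`) — two double planes, no longer `4·T` of one divisor; it is dissolved by the FREE round along the fibre `φ` of `R_ν`, not by a point step. [folklore] -/
theorem G₄L_cone (a b c x y z : R) :
    c * z ^ 2 * (x - y ^ 2) ^ 2 + b * y * z * (x ^ 2 - y * z) * (x - y ^ 2) + a * y ^ 2 * (x ^ 2 - y * z) ^ 2 =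
      c * x ^ 2 * z ^ 2 + (-(2 * c * x * y ^ 2 * z ^ 2) + c * y ^ 4 * z ^ 2 + b * x ^ 3 * y * z - b * x ^ 2 * y ^ 3 * z - b * x * y ^ 2 * z ^ 2
        + b * y ^ 4 * z ^ 2 + a * x ^ 4 * y ^ 2 - 2 * a * x ^ 2 * y ^ 3 * z + a * y ^ 4 * z ^ 2) := by
  ring

/-- [OURS · L1 W4.5b] `Z^st₄ = (t², t, t³)` lies on `T̃₄`: `G₄(t², t, t³) = 0` — after the rounds along `μ` and `ν` (no point step at `P_A`) the strict transform of `Z`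
over `q` is the smooth graph `(y², y, y³)`. [folklore] -/
theorem G₄L_vanishes_on_Zst (a b c t : R) :
    c * (t ^ 3) ^ 2 * (t ^ 2 - t ^ 2) ^ 2 + b * t * t ^ 3 * ((t ^ 2) ^ 2 - t * t ^ 3) * (t ^ 2 - t ^ 2) + a * t ^ 2 * ((t ^ 2) ^ 2 - t * t ^ 3) ^ 2 = 0 := by
  ring

/-! ### (appended, lead-1 g22 ≈14:10Z) The ∞-END of Z₁₅ (the planar point): ∞-step, the A₇ line λ_∞, the p′-step, Z^st smooth
Local coordinates at ∞ = [1:0:0:0] (w = 1… here the affine frame (v, y, z) with v := x − z³, so the branch surface S = V(f₁) is {v = 0} and Z = (0, s⁹, s⁵));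
F = a v² + b v g + c g², g := y⁵ − (v + z³)³ (idea-3 l.38509; kits j331484/j331485, `C4-LEVELS.md` §4). -/

/-- [OURS · L1 W4.5b] ∞-step, chart z (`v ↦ vz, y ↦ yz`): `F = z²·F₁`, `F₁ = a v² + b z² v g₁ + c z⁴ g₁²`, `g₁ = y⁵z² − (v + z²)³` (`Π_∞ = {z = 0}`, `St S = {v = 0}`,
`λ_∞ = V(v, z)`, `Z^st₁ = (0, s⁴, s⁵)` — still the ⟨4,5⟩ cusp, at `p′` = origin). [folklore] -/
theorem infstep_chart_z (a b c v y z : R) :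
    a * (v * z) ^ 2 + b * (v * z) * ((y * z) ^ 5 - (v * z + z ^ 3) ^ 3) + c * ((y * z) ^ 5 - (v * z + z ^ 3) ^ 3) ^ 2 =
      z ^ 2 * (a * v ^ 2 + b * z ^ 2 * v * (y ^ 5 * z ^ 2 - (v + z ^ 2) ^ 3) + c * z ^ 4 * (y ^ 5 * z ^ 2 - (v + z ^ 2) ^ 3) ^ 2) := by
  ring

/-- [OURS · L1 W4.5b] The A₇ form along `λ_∞` (idea-3 l.38509 «c w¹⁰z⁸ + b w⁵ v z⁴ + a v²»): `F₁ = (a v² + b y⁵ v z⁴ + c y¹⁰ z⁸) + remainder`, the remainder having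
(v, z)-weight ≥ 12 for the weights (v, z) = (4, 1) under which the leading part is homogeneous of weight 8 — transversal type A₇ along `λ_∞ = V(v, z)` off `y = 0`. [folklore] -/
theorem F₁inf_A7_form (a b c v y z : R) :
    a * v ^ 2 + b * z ^ 2 * v * (y ^ 5 * z ^ 2 - (v + z ^ 2) ^ 3) + c * z ^ 4 * (y ^ 5 * z ^ 2 - (v + z ^ 2) ^ 3) ^ 2 =
      (a * v ^ 2 + b * y ^ 5 * v * z ^ 4 + c * y ^ 10 * z ^ 8)
        + (-(b * z ^ 2 * v * (v + z ^ 2) ^ 3) - 2 * c * y ^ 5 * z ^ 6 * (v + z ^ 2) ^ 3 + c * z ^ 4 * (v + z ^ 2) ^ 6) := by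
  ring

/-- [OURS · L1 W4.5b] The p′-step (point step at the cusp `p′ ∈ λ_∞`), chart y (`v ↦ vy, z ↦ zy`): `F₁ = y²·F₂`, `F₂ = a v² + b y⁴z² v g₂ + c y⁸z⁴ g₂²`,
`g₂ = y⁴z² − (v + z²y)³` (`Π_{p′} = {y = 0}`, `St²S = {v = 0}`, `λ_{p′} = V(v, y)`). [folklore] -/
theorem pprime_step_chart_y (a b c v y z : R) :
    a * (v * y) ^ 2 + b * (z * y) ^ 2 * (v * y) * (y ^ 5 * (z * y) ^ 2 - (v * y + (z * y) ^ 2) ^ 3)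
        + c * (z * y) ^ 4 * (y ^ 5 * (z * y) ^ 2 - (v * y + (z * y) ^ 2) ^ 3) ^ 2 =
      y ^ 2 * (a * v ^ 2 + b * y ^ 4 * z ^ 2 * v * (y ^ 4 * z ^ 2 - (v + z ^ 2 * y) ^ 3) + c * y ^ 8 * z ^ 4 * (y ^ 4 * z ^ 2 - (v + z ^ 2 * y) ^ 3) ^ 2) := by
  ring

/-- [OURS · L1 W4.5b] `Z^st₂ = (0, s⁴, s)` lies on `V(g₂) ∩ {v = 0} ⊂ T̃₂` and is the smooth graph `y = z⁴` in `St²S`: `g₂(0, s⁴, s) = 0` — after the two point steps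
∞, p′ the strict transform of Z is REGULAR on the ∞-side (kit j331485 level 2). [folklore] -/
theorem g₂_vanishes_on_Zst (s : R) : (s ^ 4) ^ 4 * s ^ 2 - (0 + s ^ 2 * s ^ 4) ^ 3 = 0 := by
  ring

/-- [OURS · L1 W4.5b] On `St²S = {v = 0}`: `g₂(0, y, z) = y³ z² (y − z⁴)` — along `λ_{p′} = V(v, y)` the unit coefficients sit on `v²`, `v·y⁷`, `y¹⁴` (z ≠ 0):
transversal type A₁₃ (idea-3 l.38509; kit j331485 `C2.2 type A13`), and `Z^st₂ = {y = z⁴}` has contact 4 with `λ_{p′}` inside `St²S`. [folklore] -/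
theorem g₂_on_StS (y z : R) : y ^ 4 * z ^ 2 - (0 + z ^ 2 * y) ^ 3 = y ^ 3 * z ^ 2 * (y - z ^ 4) := by
  ring

end SpecimenRationalNose615

end Summit.ResolutionOfSingularities.ResolutionOfSingularities.Cruxes.EquisingularLiftNat.Sections
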